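import Mathlib
import HarnessLib

/-!
# Big-image torsion core, helpers 1/5: torsion filtration and spanning families

Helper file (1/5) for stub `stub_bigImageTorsionCore` ((N†), the big-image torsion core) of
line `Sketch` (isotypic–Minkowski reduction) of crux U
`Summit.ABC.ABC.Theses.IsogenyGlueCongruence.EllipticGluingPrimeBound` (stmt-ABC-13919); the stub
itself is proved in `…EllipticGluingPrimeBoundStubBigImageTorsionCore`.

Pure algebra (namespace `…IsotypicMinkowski.BigImage`):
* `exists_stable_torsion_onto` (registered sub-goal) — the substitute for Brauer–Nesbitt on
    lattices: if a stable
  subgroup killed by `ℓᵏ` surjects equivariantly onto an irreducible module `V`, some stable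
  subgroup killed by `ℓ` does (induction on `k` through `M'[ℓ]` and `ℓ M'`);
* `submodule_matrix_eq_top` — a conjugation-stable subspace of `M₂(𝔽_ℓ)` (`ℓ` odd) containing `1`
  and a non-scalar matrix is everything (unipotent conjugates produce `E₀₁`);
* `forall_mem_of_span_eq_top`, `exists_eq_smul_of_commute` (Schur for a spanning family on a
  plane), `eq_bot_or_eq_top_of_span_eq_top` (irreducibility from a spanning family).

Everything is proved (axioms `propext`, `Classical.choice`, `Quot.sound`); no `def`, no named
fact. Deliberately NOT here: any geometry, the Galois-theoretic input (helpers 2/5).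
-/

noncomputable section

-- `Summit.<Summit>.<Problem>` is the mandated summit-side namespace (CONVENTIONS §2); for the
-- single-conjunct summit `ABC` the two coincide, so the duplicate `ABC.ABC` is deliberate.
set_option linter.dupNamespace false

namespace Summit.ABC.ABC.Theorems.IsotypicMinkowski

open scoped AddSubgroup

/-! ## Torsion filtration (registered sub-goal of the stub) -/

/-- **Torsion filtration (Brauer–Nesbitt substitute).** Operators `s i` on an additive group
`M`, operators `t i` on an additive group `V` with no proper non-zero `t`-stable subgroup.
If an `s`-stable subgroup `M'` killed by `ℓ ^ k` surjects equivariantly onto `V`, then some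
`s`-stable subgroup `S ≤ M'` killed by `ℓ` surjects equivariantly onto `V`: either `M'[ℓ]`
already surjects (its image is stable, hence everything or zero), or the surjection factors
through `ℓ M' ≅ M'/M'[ℓ]`, killed by `ℓ ^ (k - 1)`; induct. [folklore] -/
theorem exists_stable_torsion_onto {ι M V : Type} [AddCommGroup M] [AddCommGroup V]
    (s : ι → M →+ M) (t : ι → V →+ V)
    (hV : ∀ S : AddSubgroup V, (∀ i, ∀ v ∈ S, t i v ∈ S) → S = ⊥ ∨ S = ⊤) (ℓ : ℕ) :
    ∀ (k : ℕ) (M' : AddSubgroup M), (∀ x ∈ M', (ℓ ^ k) • x = 0) →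
      ∀ (hst : ∀ i, ∀ x ∈ M', s i x ∈ M') (π : M' →+ V), Function.Surjective π →
        (∀ i (x : M'), π ⟨s i x, hst i x x.2⟩ = t i (π x)) →
        ∃ (S : AddSubgroup M) (hS : ∀ i, ∀ x ∈ S, s i x ∈ S) (π' : S →+ V),
          S ≤ M' ∧ (∀ x ∈ S, ℓ • x = 0) ∧ Function.Surjective π' ∧
          ∀ i (x : S), π' ⟨s i x, hS i x x.2⟩ = t i (π' x) := by
  intro k
  induction k with
  | zero =>
    intro M' hk hst π hπ hπt
    refine ⟨M', hst, π, le_rfl, fun x hx ↦ ?_, hπ, hπt⟩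
    have h0 : x = 0 := by simpa using hk x hx
    rw [h0, smul_zero]
  | succ k ih =>
    intro M' hk hst π hπ hπt
    -- the `ℓ`-torsion `T` of `M'` and the restriction of `π` to it
    let T : AddSubgroup M := M' ⊓ (DistribSMul.toAddMonoidHom M ℓ).ker
    have hTM' : T ≤ M' := inf_le_left
    have hmemT : ∀ x, x ∈ T ↔ x ∈ M' ∧ ℓ • x = 0 := fun x ↦ by
      rw [AddSubgroup.mem_inf, AddMonoidHom.mem_ker, DistribSMul.toAddMonoidHom_apply]
    have hTℓ : ∀ x ∈ T, ℓ • x = 0 := fun x hx ↦ ((hmemT x).1 hx).2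
    have hTst : ∀ i, ∀ x ∈ T, s i x ∈ T := fun i x hx ↦
      (hmemT _).2 ⟨hst i x ((hmemT x).1 hx).1, by rw [← map_nsmul, hTℓ x hx, map_zero]⟩
    let πT : T →+ V := π.comp (AddSubgroup.inclusion hTM')
    have hπT : ∀ x : T, πT x = π ⟨x, hTM' x.2⟩ := fun x ↦ rfl
    have hrange : ∀ i, ∀ v ∈ πT.range, t i v ∈ πT.range := by
      rintro i v ⟨x, rfl⟩
      refine ⟨⟨s i x, hTst i x x.2⟩, ?_⟩
      rw [hπT, hπT, ← hπt i ⟨x, hTM' x.2⟩]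
    rcases hV πT.range hrange with hbot | htop
    · -- `π` kills the `ℓ`-torsion: factor through multiplication by `ℓ`
      have hker : ∀ x : M', ℓ • (x : M) = 0 → π x = 0 := fun x hx ↦ by
        have hxT : (x : M) ∈ T := (hmemT _).2 ⟨x.2, hx⟩
        have h : πT ⟨x, hxT⟩ ∈ πT.range := ⟨_, rfl⟩
        rw [hbot, AddSubgroup.mem_bot] at h
        rw [← h, hπT]
      let M'' : AddSubgroup M := M'.map (DistribSMul.toAddMonoidHom M ℓ)
      have hmem'' : ∀ y, y ∈ M'' ↔ ∃ x ∈ M', ℓ • x = y := fun y ↦ by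
        simp only [M'', AddSubgroup.mem_map, DistribSMul.toAddMonoidHom_apply]
      have hM''M' : M'' ≤ M' := by
        intro y hy
        obtain ⟨x, hx, rfl⟩ := (hmem'' y).1 hy
        exact M'.nsmul_mem hx ℓ
      have hk'' : ∀ y ∈ M'', (ℓ ^ k) • y = 0 := by
        intro y hy
        obtain ⟨x, hx, rfl⟩ := (hmem'' y).1 hy
        rw [smul_smul, ← pow_succ, hk x hx]
      have hst'' : ∀ i, ∀ y ∈ M'', s i y ∈ M'' := by
        intro i y hy
        obtain ⟨x, hx, rfl⟩ := (hmem'' y).1 hy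
        exact (hmem'' _).2 ⟨s i x, hst i x hx, by rw [map_nsmul]⟩
      -- multiplication by `ℓ` as a surjection `M' → M''`
      let f : M' →+ M'' :=
        ((DistribSMul.toAddMonoidHom M ℓ).comp M'.subtype).codRestrict M''
          (fun x ↦ (hmem'' _).2 ⟨x, x.2, rfl⟩)
      have hf_apply : ∀ x : M', (f x : M) = ℓ • (x : M) := fun x ↦ rfl
      have hf : Function.Surjective f := by
        rintro ⟨y, hy⟩
        obtain ⟨x, hx, rfl⟩ := (hmem'' y).1 hy
        exact ⟨⟨x, hx⟩, Subtype.ext (hf_apply _)⟩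
      have hfker : f.ker ≤ π.ker := by
        intro x hx
        rw [AddMonoidHom.mem_ker] at hx ⊢
        exact hker x (by rw [← hf_apply, hx]; rfl)
      let π'' : M'' →+ V := f.liftOfSurjective hf ⟨π, hfker⟩
      have hπ''f : ∀ x : M', π'' (f x) = π x := fun x ↦
        f.liftOfRightInverse_comp_apply _ _ ⟨π, hfker⟩ x
      have hπ''surj : Function.Surjective π'' := by
        intro v
        obtain ⟨x, rfl⟩ := hπ v
        exact ⟨f x, hπ''f x⟩
      have hπ''t : ∀ i (y : M''), π'' ⟨s i y, hst'' i y y.2⟩ = t i (π'' y) := by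
        intro i y
        obtain ⟨x, rfl⟩ := hf y
        have h1 : (⟨s i (f x : M), hst'' i _ (f x).2⟩ : M'') = f ⟨s i x, hst i x x.2⟩ := by
          apply Subtype.ext
          change s i (f x : M) = ((f ⟨s i x, hst i x x.2⟩ : M'') : M)
          rw [hf_apply, hf_apply, map_nsmul]
        rw [h1, hπ''f, hπ''f, hπt]
      obtain ⟨S, hS, π', hSM'', hSℓ, hπ's, hπ't⟩ := ih M'' hk'' hst'' π'' hπ''surj hπ''t
      exact ⟨S, hS, π', hSM''.trans hM''M', hSℓ, hπ's, hπ't⟩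
    · refine ⟨T, hTst, πT, hTM', hTℓ, AddMonoidHom.range_eq_top.1 htop, fun i x ↦ ?_⟩
      rw [hπT, hπT, ← hπt i ⟨x, hTM' x.2⟩]

namespace BigImage

/-! ## Conjugation-stable subspaces of `M₂(𝔽_ℓ)` -/

/-- **Conjugation-stable subspaces of `M₂(𝔽_ℓ)`, `ℓ` odd.** A linear subspace `𝒜` of the
`2 × 2` matrices over `𝔽_ℓ` (`ℓ ≠ 2`) which contains `1`, is stable under conjugation by
invertible matrices and contains a non-scalar matrix is everything: unipotent conjugates of the
non-scalar element produce an elementary matrix `E₀₁`, whose conjugates then span. (The adjoint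
representation of `GL₂` on `𝔰𝔩₂` is irreducible in odd characteristic.) [folklore] -/
theorem submodule_matrix_eq_top {ℓ : ℕ} [Fact ℓ.Prime] (hℓ : ℓ ≠ 2)
    (𝒜 : Submodule (ZMod ℓ) (Matrix (Fin 2) (Fin 2) (ZMod ℓ)))
    (h1 : (1 : Matrix (Fin 2) (Fin 2) (ZMod ℓ)) ∈ 𝒜)
    (hconj : ∀ g g' : Matrix (Fin 2) (Fin 2) (ZMod ℓ), g * g' = 1 → ∀ a ∈ 𝒜, g * a * g' ∈ 𝒜)
    {a : Matrix (Fin 2) (Fin 2) (ZMod ℓ)} (ha : a ∈ 𝒜)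
    (hns : a 1 0 ≠ 0 ∨ a 0 1 ≠ 0 ∨ a 0 0 ≠ a 1 1) : 𝒜 = ⊤ := by
  have h2 : (2 : ZMod ℓ) ≠ 0 := by
    intro h
    have h' : ((2 : ℕ) : ZMod ℓ) = 0 := by exact_mod_cast h
    rw [ZMod.natCast_eq_zero_iff] at h'
    have := Nat.le_of_dvd two_pos h'
    have := (Fact.out : ℓ.Prime).two_le
    omega
  -- unipotent conjugates: `Y_b = b₁₀ E₀₁` and `X_b` lie in `𝒜` for every `b ∈ 𝒜`
  have key : ∀ b ∈ 𝒜, !![0, b 1 0; 0, 0] ∈ 𝒜 ∧ !![b 1 0, b 1 1 - b 0 0; 0, -b 1 0] ∈ 𝒜 := by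
    intro b hb
    have hd : ∀ t : ZMod ℓ,
        t • !![b 1 0, b 1 1 - b 0 0; 0, -b 1 0] - t ^ 2 • !![0, b 1 0; 0, 0] ∈ 𝒜 := by
      intro t
      have hu : !![1, t; 0, 1] * !![1, -t; 0, 1] = (1 : Matrix (Fin 2) (Fin 2) (ZMod ℓ)) := by
        ext i j; fin_cases i <;> fin_cases j <;> simp
      have h := 𝒜.sub_mem (hconj _ _ hu b hb) hb
      convert h using 1
      rw [Matrix.eta_fin_two b]
      ext i j; fin_cases i <;> fin_cases j <;> simp <;> ring
    have hY : !![0, b 1 0; 0, 0] ∈ 𝒜 := by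
      have h := 𝒜.sub_mem (𝒜.smul_mem 2 (hd 1)) (hd 2)
      have e : (2 : ZMod ℓ) • ((1 : ZMod ℓ) • !![b 1 0, b 1 1 - b 0 0; 0, -b 1 0] -
            (1 : ZMod ℓ) ^ 2 • !![0, b 1 0; 0, 0]) -
          ((2 : ZMod ℓ) • !![b 1 0, b 1 1 - b 0 0; 0, -b 1 0] -
            (2 : ZMod ℓ) ^ 2 • !![0, b 1 0; 0, 0]) =
          (2 : ZMod ℓ) • !![0, b 1 0; 0, 0] := by
        ext i j; fin_cases i <;> fin_cases j <;> simp
        ring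
      rw [e] at h
      have h' := 𝒜.smul_mem (2 : ZMod ℓ)⁻¹ h
      rwa [inv_smul_smul₀ h2] at h'
    refine ⟨hY, ?_⟩
    have h := 𝒜.add_mem (hd 1) hY
    convert h using 1
    ext i j; fin_cases i <;> fin_cases j <;> simp
  -- the swap
  have hw : !![(0 : ZMod ℓ), 1; 1, 0] * !![0, 1; 1, 0] = 1 := by
    ext i j; fin_cases i <;> fin_cases j <;> simp
  -- Step 1: `E₀₁ ∈ 𝒜`
  have hE01 : !![(0 : ZMod ℓ), 1; 0, 0] ∈ 𝒜 := by
    by_cases h10 : a 1 0 = 0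
    · by_cases h0011 : a 0 0 = a 1 1
      · have h01 : a 0 1 ≠ 0 := by
          rcases hns with h | h | h
          · exact absurd h10 h
          · exact h
          · exact absurd h0011 h
        -- conjugate by the swap to move `a₀₁` to the lower-left corner
        have ha' := hconj _ _ hw a ha
        have h10' : (!![(0 : ZMod ℓ), 1; 1, 0] * a * !![0, 1; 1, 0] :
            Matrix (Fin 2) (Fin 2) (ZMod ℓ)) 1 0 = a 0 1 := by
          rw [Matrix.eta_fin_two a]
          simp
        have hY := (key _ ha').1
        rw [h10'] at hY
        have h := 𝒜.smul_mem (a 0 1)⁻¹ hY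
        convert h using 1
        ext i j; fin_cases i <;> fin_cases j <;> simp [inv_mul_cancel₀ h01]
      · have hX := (key a ha).2
        rw [h10] at hX
        have hne : a 1 1 - a 0 0 ≠ 0 := sub_ne_zero.2 (Ne.symm h0011)
        have h := 𝒜.smul_mem (a 1 1 - a 0 0)⁻¹ hX
        convert h using 1
        ext i j; fin_cases i <;> fin_cases j <;> simp [inv_mul_cancel₀ hne]
    · have hY := (key a ha).1
      have h := 𝒜.smul_mem (a 1 0)⁻¹ hY
      convert h using 1
      ext i j; fin_cases i <;> fin_cases j <;> simp [inv_mul_cancel₀ h10]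
  -- Step 2: the other elementary matrices
  have hE10 : !![(0 : ZMod ℓ), 0; 1, 0] ∈ 𝒜 := by
    have h := hconj _ _ hw _ hE01
    convert h using 1
    ext i j; fin_cases i <;> fin_cases j <;> simp
  have hH : !![(-1 : ZMod ℓ), 0; 0, 1] ∈ 𝒜 := by
    have hv : !![(1 : ZMod ℓ), 0; 1, 1] * !![1, 0; -1, 1] = 1 := by
      ext i j; fin_cases i <;> fin_cases j <;> simp
    have h := 𝒜.add_mem (𝒜.sub_mem (hconj _ _ hv _ hE01) hE01) hE10
    convert h using 1
    ext i j; fin_cases i <;> fin_cases j <;> simp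
  have hE00 : !![(1 : ZMod ℓ), 0; 0, 0] ∈ 𝒜 := by
    have h := 𝒜.smul_mem (2 : ZMod ℓ)⁻¹ (𝒜.sub_mem h1 hH)
    convert h using 1
    rw [eq_inv_smul_iff₀ h2]
    ext i j; fin_cases i <;> fin_cases j <;> simp
    norm_num
  have hE11 : !![(0 : ZMod ℓ), 0; 0, 1] ∈ 𝒜 := by
    have h := 𝒜.smul_mem (2 : ZMod ℓ)⁻¹ (𝒜.add_mem h1 hH)
    convert h using 1
    rw [eq_inv_smul_iff₀ h2]
    ext i j; fin_cases i <;> fin_cases j <;> simp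
    norm_num
  -- Step 3: everything
  rw [eq_top_iff]
  intro m _
  have hm : m = m 0 0 • !![(1 : ZMod ℓ), 0; 0, 0] + m 0 1 • !![(0 : ZMod ℓ), 1; 0, 0] +
      m 1 0 • !![(0 : ZMod ℓ), 0; 1, 0] + m 1 1 • !![(0 : ZMod ℓ), 0; 0, 1] := by
    ext i j; fin_cases i <;> fin_cases j <;> simp
  rw [hm]
  exact 𝒜.add_mem (𝒜.add_mem (𝒜.add_mem (𝒜.smul_mem _ hE00) (𝒜.smul_mem _ hE01))
    (𝒜.smul_mem _ hE10)) (𝒜.smul_mem _ hE11)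

/-! ## Spanning families of operators on a plane -/

/-- **Stability under a spanning set is stability under everything.** If `span S = ⊤` and a
submodule is stable under the operators `D φ`, `φ ∈ S`, of an action `D` additive and
homogeneous in `φ`, then it is stable under every `D φ`. [folklore] -/
theorem forall_mem_of_span_eq_top {R F N : Type} [Semiring R] [AddCommMonoid F] [Module R F]
    [AddCommMonoid N] [Module R N] {S : Set F} (hspan : Submodule.span R S = ⊤)
    (D : F → N → N) (hadd : ∀ φ ψ n, D (φ + ψ) n = D φ n + D ψ n)
    (hsmul : ∀ (c : R) φ n, D (c • φ) n = c • D φ n) (P : Submodule R N)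
    (hst : ∀ φ ∈ S, ∀ n ∈ P, D φ n ∈ P) (φ : F) {n : N} (hn : n ∈ P) : D φ n ∈ P := by
  let Q : Submodule R F :=
    { carrier := {ψ | D ψ n ∈ P}
      add_mem' := fun {ψ ψ'} h h' ↦ by
        change D (ψ + ψ') n ∈ P
        rw [hadd]
        exact P.add_mem h h'
      zero_mem' := by
        change D 0 n ∈ P
        rw [← zero_smul R (0 : F), hsmul, zero_smul]
        exact P.zero_mem
      smul_mem' := fun c ψ h ↦ by
        change D (c • ψ) n ∈ P
        rw [hsmul]
        exact P.smul_mem c h }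
  have hQ : Submodule.span R S ≤ Q := Submodule.span_le.2 fun ψ hψ ↦ hst ψ hψ n hn
  rw [hspan, top_le_iff] at hQ
  have : φ ∈ Q := hQ ▸ Submodule.mem_top
  exact this

/-- **Schur for a spanning family on a plane.** If linear operators spanning `End(V)`
(`dim V = 2`) all commute with `θ`, then `θ` is a scalar. [folklore] -/
theorem exists_eq_smul_of_commute {R V : Type} [Field R] [AddCommGroup V] [Module R V]
    (b : Module.Basis (Fin 2) R V) {S : Set (V →ₗ[R] V)} (hspan : Submodule.span R S = ⊤)
    (θ : V →ₗ[R] V) (hθ : ∀ φ ∈ S, φ ∘ₗ θ = θ ∘ₗ φ) : ∃ c : R, ∀ v, θ v = c • v := by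
  -- every operator commutes with `θ`
  have hall : ∀ φ : V →ₗ[R] V, φ ∘ₗ θ = θ ∘ₗ φ := by
    intro φ
    -- the centraliser of `θ` is a submodule containing `S`
    let C : Submodule R (V →ₗ[R] V) :=
      { carrier := {φ | φ ∘ₗ θ = θ ∘ₗ φ}
        add_mem' := fun {φ ψ} h h' ↦ by
          change (φ + ψ) ∘ₗ θ = θ ∘ₗ (φ + ψ)
          rw [LinearMap.add_comp, LinearMap.comp_add, h, h']
        zero_mem' := by
          change (0 : V →ₗ[R] V) ∘ₗ θ = θ ∘ₗ 0
          rw [LinearMap.zero_comp, LinearMap.comp_zero]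
        smul_mem' := fun c φ h ↦ by
          change (c • φ) ∘ₗ θ = θ ∘ₗ (c • φ)
          rw [LinearMap.smul_comp, LinearMap.comp_smul, h] }
    have hC : Submodule.span R S ≤ C := Submodule.span_le.2 fun ψ hψ ↦ hθ ψ hψ
    rw [hspan, top_le_iff] at hC
    have : φ ∈ C := hC ▸ Submodule.mem_top
    exact this
  -- test against `v ↦ v₀ b₀` and `v ↦ v₀ b₁`
  set a := b.repr (θ (b 0)) 0 with ha
  have hP := LinearMap.congr_fun (hall ((b.coord 0).smulRight (b 0))) (b 0)
  have hN := LinearMap.congr_fun (hall ((b.coord 0).smulRight (b 1))) (b 0)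
  simp only [LinearMap.coe_comp, Function.comp_apply, LinearMap.smulRight_apply,
    Module.Basis.coord_apply, Module.Basis.repr_self, Finsupp.single_eq_same, one_smul] at hP hN
  -- `hP : a • b 0 = θ (b 0)`, `hN : a • b 1 = θ (b 1)`
  refine ⟨a, fun v ↦ ?_⟩
  have hv := b.sum_repr v
  rw [Fin.sum_univ_two] at hv
  rw [← hv, map_add, map_smul, map_smul, ← hP, ← hN, smul_add, smul_comm (b.repr v 0) a,
    smul_comm (b.repr v 1) a]

/-- **Irreducibility from a spanning family on a plane**: an additive subgroup of `V`
(`dim V = 2` over a field) stable under a spanning set of `End(V)` is `⊥` or `⊤`. [folklore] -/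
theorem eq_bot_or_eq_top_of_span_eq_top {R V : Type} [Field R] [AddCommGroup V] [Module R V]
    (b : Module.Basis (Fin 2) R V) {S : Set (V →ₗ[R] V)} (hspan : Submodule.span R S = ⊤)
    (P : Submodule R V) (hst : ∀ φ ∈ S, ∀ v ∈ P, φ v ∈ P) : P = ⊥ ∨ P = ⊤ := by
  rw [or_iff_not_imp_left]
  intro hbot
  obtain ⟨v, hvP, hv0⟩ : ∃ v ∈ P, v ≠ 0 := by
    by_contra h
    push Not at h
    exact hbot ((Submodule.eq_bot_iff _).2 h)
  obtain ⟨i, hi⟩ : ∃ i, b.repr v i ≠ 0 := by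
    by_contra h
    push Not at h
    exact hv0 (b.repr.map_eq_zero_iff.1 (Finsupp.ext h))
  rw [eq_top_iff]
  intro w _
  have h := forall_mem_of_span_eq_top hspan (fun (φ : V →ₗ[R] V) (v : V) ↦ φ v)
    (fun φ ψ n ↦ rfl) (fun c φ n ↦ rfl) P hst ((b.coord i).smulRight ((b.repr v i)⁻¹ • w)) hvP
  simpa only [LinearMap.smulRight_apply, Module.Basis.coord_apply, smul_smul,
    mul_inv_cancel₀ hi, one_smul] using h

end BigImage

end Summit.ABC.ABC.Theorems.IsotypicMinkowski

end
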